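import Summits.AtomisticToContinuum.Crystallization.Theorems.SlackRigidity.Negative.WitnessBasics
import Summits.AtomisticToContinuum.Crystallization.Theorems.ChargedEnergyGap.Negative.Unconditional
import Literature.Probability.Process.LocallyMatches
import HarnessLib

/-!
# `SlackRigidity` (stmt-AtomisticToContinuum-11960): bad clusters padded with ground states

Support file for the crux `ThreeConeCertificate.SlackRigidity` (line `ekeland-surgery-parity`,
registered necessary-condition stub `not_rigidFor_of_badClusters` of lead c14's law-rigidity
programme, worker W2).

MAIN RESULT (`not_rigidFor_of_badClusters`).  Fix a periodic template `P₀`, a window radius `R > 0`,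
a tolerance `ε > 0` and a proportion `b > 0`.  Suppose that for every slack `η > 0` and every size
`M` there is a finite cluster `T ⊆ ℝ³` with `#T ≥ M`, Lennard-Jones energy
`E(T) ≤ #T · e* + η · #T` (`e* = ⨅_Q e(Q)` over periodic `Q`), and at least `b · #T` points `y ∈ T`
that are `(R, ε)`-BAD WITHIN THE CLUSTER: no linear isometry `A` two-way `ε`-matches `T - y` with
`A(P₀.points)` on the central `R`-ball.  Then `P₀` is not a witness of `SlackRigidity`
(`¬ RigidFor P₀`).

MECHANISM.  Choose such clusters `S k` with slack `1/(k+1)` and strictly increasing sizes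
(`exists_clusterSeq`), enumerate them by `Finset.equivFin`, and fill every other particle number
`N` with a ground state (`exists_paddedSeq`).  The padded sequence is injective and, since
`E(N) ≥ N · e*` (`eStar_le_groundStateEnergy_div`) and `E(N) ≤ E(S k)`
(`groundStateEnergy_lennardJones_le`), its energy excess is `≤ #S_k/(k+1) = o(N)`; so `RigidFor P₀`
would make its bad fraction vanish.  But "bad within the cluster" is exactly the crux's `¬ Good` for
the enumerated cluster (`good_enum_iff`, `natCard_bad_eq`), so along the sizes `#S_k → ∞` the bad
fraction stays `≥ b` — a contradiction.  A direct mirror of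
`SlackRigidityPinsMinimisers.exists_blockSeq` / `false_of_badFractionVanishes`.  All `[folklore]`.
-/

noncomputable section

open scoped BigOperators Topology
open MeasureTheory Filter Set
open Literature.Probability.Process
open Literature.MathematicalPhysics.StatisticalMechanics
open Summit.AtomisticToContinuum.Crystallization.Theorems.SlackRigidityNegative
open Summit.AtomisticToContinuum.Crystallization.Theorems.ChargedEnergyGapNegative (eStar eStar_le_groundStateEnergy_div card_mul_eStar_le)

namespace Summit.AtomisticToContinuum.Crystallization.Theorems.SlackRigidityLawPadding

/-! ## § The enumeration of a finite cluster and the dictionary `Good` ↔ `LocallyMatches` -/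

/-- The enumeration `i ↦ T.equivFin.symm i` of a finite cluster is injective. [folklore] -/
theorem enum_injective (T : Finset E3) :
    Function.Injective fun i : Fin T.card => ((T.equivFin.symm i : T) : E3) :=
  Subtype.val_injective.comp T.equivFin.symm.injective

/-- The enumeration of a finite cluster has range the cluster. [folklore] -/
theorem range_enum (T : Finset E3) :
    Set.range (fun i : Fin T.card => ((T.equivFin.symm i : T) : E3)) = (T : Set E3) := by
  ext v
  simp only [Set.mem_range, Finset.mem_coe]
  constructor
  · rintro ⟨i, rfl⟩
    exact (T.equivFin.symm i).2
  · intro hv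
    exact ⟨T.equivFin ⟨v, hv⟩, by rw [Equiv.symm_apply_apply]⟩

/-- The crux's matching predicate `Good P₀ R ε x i` is local `(R, ε)`-matching of the configuration
`Set.range x` recentred at `x i` with a rotated template. [folklore] -/
theorem good_iff_image (P₀ : PeriodicConfiguration 3) (R ε : ℝ) {N : ℕ} (x : Fin N → E3)
    (i : Fin N) :
    Good P₀ R ε x i ↔ ∃ A : E3 →ₗᵢ[ℝ] E3,
      LocallyMatches R ε ((fun z : E3 => z - x i) '' Set.range x) (A '' P₀.points) := by
  have hr : (fun z : E3 => z - x i) '' Set.range x = Set.range fun j => x j - x i := by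
    ext v
    simp only [Set.mem_image, Set.mem_range, exists_exists_eq_and]
  rw [hr]
  unfold Good
  refine exists_congr fun A => ?_
  have h := locallyMatches_range_sub_pattern_iff (R := R) (ε := ε) x i A P₀.points 0
  simp only [sub_zero, dist_zero_right] at h
  exact h.symm

/-- Dictionary: the particle `T.equivFin y` of the enumerated cluster is `(R, ε)`-good for `P₀` iff
the cluster recentred at `y` locally matches a rotated copy of `P₀.points`. [folklore] -/
theorem good_enum_iff (P₀ : PeriodicConfiguration 3) (R ε : ℝ) (T : Finset E3) (y : T) :
    Good P₀ R ε (fun i : Fin T.card => ((T.equivFin.symm i : T) : E3)) (T.equivFin y) ↔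
      ∃ A : E3 →ₗᵢ[ℝ] E3,
        LocallyMatches R ε ((fun z : E3 => z - (y : E3)) '' (T : Set E3)) (A '' P₀.points) := by
  rw [good_iff_image, range_enum, Equiv.symm_apply_apply]

/-- Counting: the points of `T` that are bad within the cluster are the bad particles of the
enumerated cluster. [folklore] -/
theorem natCard_bad_eq (P₀ : PeriodicConfiguration 3) (R ε : ℝ) (T : Finset E3) :
    Nat.card {y : T // ¬ ∃ A : E3 →ₗᵢ[ℝ] E3,
        LocallyMatches R ε ((fun z : E3 => z - (y : E3)) '' (T : Set E3)) (A '' P₀.points)} =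
      badCount P₀ R ε (fun i : Fin T.card => ((T.equivFin.symm i : T) : E3)) := by
  unfold badCount
  exact Nat.card_congr
    (Equiv.subtypeEquiv T.equivFin fun y => not_congr (good_enum_iff P₀ R ε T y).symm)

/-! ## § A sequence of bad clusters with strictly increasing sizes and shrinking slack -/

/-- From the supply of bad clusters: clusters `S k` of strictly increasing (positive) sizes, energy
`E(S k) ≤ #S_k · e* + #S_k/(k+1)` and at least `b · #S_k` bad particles. [folklore] -/
theorem exists_clusterSeq {P₀ : PeriodicConfiguration 3} {R ε b : ℝ}
    (hsup : ∀ (η : ℝ) (M : ℕ), 0 < η → ∃ T : Finset E3, M ≤ T.card ∧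
      interactionEnergy lennardJones (fun i : Fin T.card => ((T.equivFin.symm i : T) : E3)) ≤
        (T.card : ℝ) * (⨅ Q : PeriodicConfiguration 3, Q.energyPerParticle lennardJones) +
          η * T.card ∧
      b * T.card ≤ (Nat.card {y : T // ¬ ∃ A : E3 →ₗᵢ[ℝ] E3,
        LocallyMatches R ε ((fun z : E3 => z - (y : E3)) '' (T : Set E3)) (A '' P₀.points)} : ℝ)) :
    ∃ S : ℕ → Finset E3, (StrictMono fun k => (S k).card) ∧ (∀ k, 0 < (S k).card) ∧
      ∀ k, interactionEnergy lennardJones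
            (fun i : Fin (S k).card => (((S k).equivFin.symm i : S k) : E3)) ≤
          ((S k).card : ℝ) * eStar + 1 / ((k : ℝ) + 1) * (S k).card ∧
        b * (S k).card ≤
          (badCount P₀ R ε (fun i : Fin (S k).card => (((S k).equivFin.symm i : S k) : E3)) : ℝ) := by
  have hsup' : ∀ k M : ℕ, ∃ T : Finset E3, M ≤ T.card ∧
      interactionEnergy lennardJones (fun i : Fin T.card => ((T.equivFin.symm i : T) : E3)) ≤
        (T.card : ℝ) * eStar + 1 / ((k : ℝ) + 1) * T.card ∧
      b * T.card ≤ (badCount P₀ R ε (fun i : Fin T.card => ((T.equivFin.symm i : T) : E3)) : ℝ) := by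
    intro k M
    obtain ⟨T, hM, hE, hb⟩ := hsup (1 / ((k : ℝ) + 1)) M (by positivity)
    refine ⟨T, hM, hE, ?_⟩
    rwa [natCard_bad_eq] at hb
  choose T hTM hTE hTb using hsup'
  -- sizes: `n 0 = 1`, `n (k+1) = #T_k + 1`; clusters `S k := T k (n k)`
  obtain ⟨n, hn0, hns⟩ : ∃ n : ℕ → ℕ, n 0 = 1 ∧ ∀ k, n (k + 1) = (T k (n k)).card + 1 :=
    ⟨fun k => Nat.rec (motive := fun _ => ℕ) 1 (fun k nk => (T k nk).card + 1) k, rfl,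
      fun _ => rfl⟩
  refine ⟨fun k => T k (n k), ?_, ?_, fun k => ⟨hTE k (n k), hTb k (n k)⟩⟩
  · refine strictMono_nat_of_lt_succ fun k => ?_
    show (T k (n k)).card < (T (k + 1) (n (k + 1))).card
    have h1 := hTM (k + 1) (n (k + 1))
    have h2 := hns k
    omega
  · intro k
    show 0 < (T k (n k)).card
    have h1 := hTM k (n k)
    cases k with
    | zero => omega
    | succ k =>
      have h2 := hns k
      omega

/-! ## § The padded sequence: clusters at their sizes, ground states elsewhere -/

/-- Re-indexing an enumerated cluster along an equality of sizes gives back the cluster. [folklore] -/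
theorem enum_cast_eq {S : ℕ → Finset E3} (hS : Function.Injective fun k => (S k).card) {k k' : ℕ}
    (h : (S k').card = (S k).card) :
    (fun i : Fin (S k).card => (((S k').equivFin.symm (Fin.cast h.symm i) : S k') : E3)) =
      fun i => (((S k).equivFin.symm i : S k) : E3) := by
  obtain rfl : k' = k := hS h
  rfl

/-- **Padding.** For clusters `S k` of pairwise distinct sizes there is a sequence
`x N : Fin N → ℝ³` which at every size `N = #S_k` IS the enumerated cluster `S k` and elsewhere is a
ground state. [folklore] -/
theorem exists_paddedSeq {S : ℕ → Finset E3} (hS : StrictMono fun k => (S k).card) :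
    ∃ x : (N : ℕ) → Fin N → E3, (∀ N, (¬ ∃ k, (S k).card = N) → x N = gs N) ∧
      ∀ k, x (S k).card = fun i => (((S k).equivFin.symm i : S k) : E3) := by
  classical
  obtain ⟨x, hx⟩ : ∃ x : (N : ℕ) → Fin N → E3, ∀ N, x N =
      if h : ∃ k, (S k).card = N then
        fun i => (((S (Classical.choose h)).equivFin.symm
          (Fin.cast (Classical.choose_spec h).symm i) : S (Classical.choose h)) : E3)
      else gs N := ⟨_, fun N => rfl⟩
  refine ⟨x, fun N h => by rw [hx, dif_neg h], fun k => ?_⟩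
  have h : ∃ k', (S k').card = (S k).card := ⟨k, rfl⟩
  rw [hx, dif_pos h]
  exact enum_cast_eq hS.injective (Classical.choose_spec h)

/-! ## § Main result -/

/-- **Bad clusters of unbounded size with `o(#T)` excess refute `RigidFor P₀`** (registered stub
`not_rigidFor_of_badClusters` of crux stmt-AtomisticToContinuum-11960, line `ekeland-surgery-parity`):
if for every slack `η > 0` and size `M` there is a finite cluster `T` with `#T ≥ M`,
`E(T) ≤ #T · e* + η #T` and at least `b #T` points that are `(R, ε)`-bad within the cluster, then
the clusters padded with ground states form an admissible sequence whose bad fraction does not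
vanish, so `P₀` is not a witness of `SlackRigidity`. [folklore] -/
theorem not_rigidFor_of_badClusters : ∀ (P₀ : PeriodicConfiguration 3) (R ε b : ℝ), 0 < R → 0 < ε → 0 < b → (∀ (η : ℝ) (M : ℕ), 0 < η → ∃ T : Finset E3, M ≤ T.card ∧ interactionEnergy lennardJones (fun i : Fin T.card => ((T.equivFin.symm i : T) : E3)) ≤ (T.card : ℝ) * (⨅ Q : PeriodicConfiguration 3, Q.energyPerParticle lennardJones) + η * T.card ∧ b * T.card ≤ (Nat.card {y : T // ¬ ∃ A : E3 →ₗᵢ[ℝ] E3, LocallyMatches R ε ((fun z : E3 => z - (y : E3)) '' (T : Set E3)) (A '' P₀.points)} : ℝ)) → ¬ RigidFor P₀ := by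
  intro P₀ R ε b hR hε hb hsup hrig
  obtain ⟨S, hmono, hpos, hS⟩ := exists_clusterSeq hsup
  obtain ⟨x, hother, hblock⟩ := exists_paddedSeq hmono
  -- every `x N` consists of distinct points
  have hinj : ∀ N, Function.Injective (x N) := by
    intro N
    by_cases h : ∃ k, (S k).card = N
    · obtain ⟨k, rfl⟩ := h
      rw [hblock k]
      exact enum_injective (S k)
    · rw [hother N h]
      exact gs_injective N
  -- the energy excess is `o(N)`
  have hexc : ExcessVanishes x := by
    rw [ExcessVanishes, Metric.tendsto_atTop]
    intro δ hδ
    obtain ⟨k₀, hk₀⟩ := exists_nat_one_div_lt hδ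
    refine ⟨(S k₀).card, fun N hN => ?_⟩
    have hNpos : 0 < N := lt_of_lt_of_le (hpos k₀) hN
    have hNr : (0 : ℝ) < N := by exact_mod_cast hNpos
    rw [Real.dist_eq, sub_zero]
    by_cases h : ∃ k, (S k).card = N
    · obtain ⟨k, rfl⟩ := h
      rw [hblock k]
      have hkk₀ : k₀ ≤ k := not_lt.1 fun hlt => absurd hN (not_le.2 (hmono hlt))
      obtain ⟨hE, -⟩ := hS k
      have hlow := groundStateEnergy_lennardJones_le (d := 3) (enum_injective (S k))
      have hes := eStar_le_groundStateEnergy_div hNpos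
      rw [le_div_iff₀ hNr] at hes
      have hkr : (k₀ : ℝ) + 1 ≤ (k : ℝ) + 1 := by
        have : (k₀ : ℝ) ≤ k := by exact_mod_cast hkk₀
        linarith
      have hk : 1 / ((k : ℝ) + 1) ≤ 1 / ((k₀ : ℝ) + 1) :=
        one_div_le_one_div_of_le (by positivity) hkr
      have h1 : 1 / ((k : ℝ) + 1) * ((S k).card : ℝ) ≤ 1 / ((k₀ : ℝ) + 1) * ((S k).card : ℝ) :=
        mul_le_mul_of_nonneg_right hk hNr.le
      have h2 : 1 / ((k₀ : ℝ) + 1) * ((S k).card : ℝ) < δ * ((S k).card : ℝ) :=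
        mul_lt_mul_of_pos_right hk₀ hNr
      rw [abs_lt]
      constructor
      · have h0 : 0 ≤ (interactionEnergy lennardJones
            (fun i : Fin (S k).card => (((S k).equivFin.symm i : S k) : E3)) -
              groundStateEnergy lennardJones 3 (S k).card) / (((S k).card : ℕ) : ℝ) :=
          div_nonneg (by linarith) hNr.le
        linarith
      · rw [div_lt_iff₀ hNr]
        linarith
    · rw [hother N h, (gs_isGroundState N).2, sub_self, zero_div, abs_zero]
      exact hδ
  -- along the cluster sizes the bad fraction tends to `0` …
  have hT : BadFractionVanishes P₀ R ε x := hrig R ε hR hε x hinj hexc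
  have hT' : Tendsto (fun k : ℕ => (badCount P₀ R ε (x (S k).card) : ℝ) /
      (((S k).card : ℕ) : ℝ)) atTop (𝓝 0) :=
    hT.comp hmono.tendsto_atTop
  have hev : ∀ᶠ k : ℕ in atTop, (badCount P₀ R ε (x (S k).card) : ℝ) /
      (((S k).card : ℕ) : ℝ) < b :=
    hT'.eventually (gt_mem_nhds hb)
  obtain ⟨k, hk⟩ := hev.exists
  -- … but it is at least `b` at every cluster size
  rw [hblock k] at hk
  obtain ⟨-, hbad⟩ := hS k
  have hNr : (0 : ℝ) < (S k).card := by exact_mod_cast hpos k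
  rw [div_lt_iff₀ hNr] at hk
  linarith

end Summit.AtomisticToContinuum.Crystallization.Theorems.SlackRigidityLawPadding

end
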